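import Summits.BirchSwinnertonDyer.BirchSwinnertonDyer.Theorems.PrintCf2RubinValueTwoLinePinDefectCharIdeal
import Summits.BirchSwinnertonDyer.BirchSwinnertonDyer.Theorems.PrintCf2RubinValueTwoLinePinDefectDual
import Summits.BirchSwinnertonDyer.Rank1Residual.X2.NonPrimitiveSelmerCorank
import Literature.NumberTheory.EllipticCurves.TwoVariableSelmerTower
import HarnessLib

/-!
# M-LINE-PIN, (C2b) part 3: THE `ℤ_p`-CORANK DICTIONARY FOR THE `v̄`-DEFECT —
# `λ(ker φ̄) = corank_{ℤ_p}(coker g)`, hence `ch_Λ(ker φ̄) = ((1+T) − u)^{corank(coker g)}` for an undecomposed `v̄`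

Cell `bsd-print-cf2`, width seat `bsd-line-cf2c-w8` g4 (prover-bsd-line-cf2c-w8-g4-0), planner g19's named piece M-LINE-PIN, step (C2b)
of the memo `Cruxes/TwoVariableMainConjAtSplitTwo/M-LINE-PIN-cf2c-w8g3.md` §2/§8. Sequel of part 1 (p700499, the Euler-factor annihilator),
part 2 (p701343, `ch_Λ(ker φ̄) = ((1+T) − u)^{λ(ker φ̄)}`), and of cf2c-w2 g4's DEFECT DUAL PAIR p699750 (`…LinePinDefectDual`:
`ker φ̄ ≅ Hom(coker g, ℚ/ℤ)` for any presentation `πC` of the cokernel of control). `--supports stmt-BirchSwinnertonDyer-24086 --as helper`,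
Theses-free. HONEST FRAMING: assembly; it converts the characteristic ideal of the `v̄`-defect module into ONE number on the discrete side
— the `ℤ_p`-corank of the cokernel of the slot-1 control `g : H¹_nr(K_∞, M) → H¹_nr(K̃_∞, M)^{γ₂=1}` — so that (LS)_v enters M-LINE-PIN as
«`corank_{ℤ_p}(coker g) = 1`»; it does NOT prove (LS)_v, nor the bound `corank ≤ 1` (the defect embedding, cf2c-w2 g4's lane); no summit
statement is proved by this seat; BSD is not proved by any of this. THEOREMS ONLY (no definition, no named fact, no `sorry`).

WHAT. In the setting of parts 1–2 (generator pair, `M` discrete `p`-primary with continuous orbits, partner unramified outside `𝔮 = v̄`,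
`pairKer ⊓ I_𝔮` trivial on `M`, `τ ∈ D_𝔮` with `κ τ = κ γ` acting on `M` as `u ≡ 1 (mod p)`, `D₂.X` f.g. over `Λ₂`), for ANY `Λ`-linear
descent `φ̄` of the transpose of control and ANY presentation `πC : H¹_nr(K̃_∞, M)^{γ₂=1} ↠ C` with `πC s = 0 ↔ s ∈ im g`:
* `finite_torsionBy_and_zpCorank_eq_lambdaInvariant_ker_liftQ` — `C[p]` is finite and **`corank_{ℤ_p} C = λ(ker φ̄)`**
  (`μ(ker φ̄) = 0` since `(1+T) − u ∉ (p)` kills it; cf2c-w2 g4's `exists_defectDual` / `defectDual_injective` / `defectDual_surjective`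
  give `ker φ̄ ≃+ Hom(C, ℚ/ℤ)`; then `X2.NonPrimitiveSelmerCorank.finite_torsionBy_and_zpCorank_eq_lambdaInvariant`).
* `charIdeal_ker_liftQ_eq_span_pow_zpCorank` — **`ch_Λ(ker φ̄) = ((1+T) − u)^{corank_{ℤ_p} C}`**;
  `charIdeal_ker_liftQ_eq_span_of_zpCorank_eq_one` — (LS)_v form: `corank_{ℤ_p} C = 1 ⟹ ch_Λ(ker φ̄) = ((1+T) − u)`.
presearch: Greenberg LNM 1716 §1 p. 60 (`λ = rank_{ℤ_p} X`), Greenberg–Vatsal 2000 Cor. (2.3)/Prop. (2.4) — tree theorems; assembly.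
beyond-print theorem: no.

References: [GreenbergLNM1716] §1, §3–4; [GreenbergVatsal2000] §2 Cor. (2.3), Prop. (2.4); [Washington1997] §13.2.
-/

noncomputable section

open scoped Classical Pointwise AddSubgroup Polynomial

-- the summit namespace `Summit.BirchSwinnertonDyer.BirchSwinnertonDyer` repeats the problem name by design (D-0017)
set_option linter.dupNamespace false
set_option autoImplicit false

open NumberField IsDedekindDomain Field Literature.NumberTheory.GaloisRepresentations
  Literature.NumberTheory.EllipticCurves Literature.NumberTheory.EllipticCurves.Module
  Literature.NumberTheory.EllipticCurves.IwasawaAlgebra Literature.NumberTheory.EllipticCurves.GreenbergSelmer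
  Literature.NumberTheory.EllipticCurves.GreenbergVatsal2000 Literature.NumberTheory.EllipticCurves.KellerYin2024
  Literature.NumberTheory.EllipticCurves.IwasawaDual

universe u

namespace Summit.BirchSwinnertonDyer.BirchSwinnertonDyer.Theorems.PrintCf2.LinePin

section Coeff

variable {p : ℕ} [Fact p.Prime]

/-- The `T^n`-coefficient of `(1+T)^n − u` is `1` for `n ≠ 0`; hence `p ∤ (1+T)^n − u` in `Λ`. [folklore] -/
theorem not_C_p_dvd_one_add_X_pow_sub_intCast {n : ℕ} (hn : n ≠ 0) (u : ℤ) :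
    ¬ (PowerSeries.C (p : ℤ_[p]) : IwasawaAlgebra p) ∣ ((1 : IwasawaAlgebra p) + PowerSeries.X) ^ n - (u : IwasawaAlgebra p) := by
  rintro ⟨w, hw⟩
  have hcoe : (((1 + Polynomial.X) ^ n : ℤ_[p][X]) : IwasawaAlgebra p) = ((1 : IwasawaAlgebra p) + PowerSeries.X) ^ n := by
    rw [Polynomial.coe_pow, Polynomial.coe_add, Polynomial.coe_one, Polynomial.coe_X]
  have h := congrArg (PowerSeries.coeff n) hw
  have hu' : PowerSeries.coeff n ((u : IwasawaAlgebra p)) = 0 := by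
    rw [← map_intCast (PowerSeries.C (R := ℤ_[p])) u, PowerSeries.coeff_C, if_neg hn]
  rw [map_sub, ← hcoe, Polynomial.coeff_coe, Polynomial.coeff_one_add_X_pow, Nat.choose_self, Nat.cast_one, hu', sub_zero,
    PowerSeries.coeff_C_mul] at h
  exact (PadicInt.irreducible_p (p := p)).not_isUnit (IsUnit.of_mul_eq_one _ h.symm)

end Coeff

variable {K : Type u} [Field K] [NumberField K] {p : ℕ} [Fact p.Prime] {κ κ₂ : ZpExtension K p}
  {M : Type u} [AddCommGroup M] [DistribMulAction (absoluteGaloisGroup K) M] [TopologicalSpace M] [DiscreteTopology M]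
  {𝔮 : HeightOneSpectrum (𝓞 K)} {γ γ₂ : absoluteGaloisGroup K}
  {g : unrSelmer κ M 𝔮 ∅ →+ unrSelmer₂ κ κ₂ M 𝔮}
  (hg : ∀ t : unrSelmer κ M 𝔮 ∅,
    ((g t : unrSelmer₂ κ κ₂ M 𝔮) : subgroupH1 (ZpExtension.pairKer κ κ₂) M) =
      resOfLe M (ZpExtension.pairKer_le_left κ κ₂) (t : subgroupH1 κ.kerSubgroup M))
  {D₂ : DualData₂ κ κ₂ M 𝔮 γ γ₂} {D₁ : DatumDualData κ γ M (Castella2018.AcSelmer.bdpData M p 𝔮) ∅}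
  {φ : D₂.X →ₛₗ[PowerSeries.map (PowerSeries.constantCoeff (R := ℤ_[p]))] D₁.X}
  (hφ : ∀ (x : D₂.X) (t : unrSelmer κ M 𝔮 ∅), D₁.toDual (φ x) t = D₂.toDual x (g t))
include hg hφ

/-- **`C[p]` IS FINITE AND `corank_{ℤ_p}(C) = λ(ker φ̄)`** for any presentation `πC : H¹_nr(K̃_∞, M)^{γ₂=1} ↠ C` of the cokernel of the
slot-1 control (`πC s = 0 ↔ s ∈ im g`), when `v̄` is undecomposed in the line (`κ τ = κ γ`, `τ ∈ D_𝔮` acting on `M` as `u ≡ 1 (mod p)`):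
`ker φ̄` is finitely generated torsion with `μ = 0` (killed by the distinguished `(1+T) − u`, parts 1–2) and is the character group of `C`
(cf2c-w2 g4's defect dual pair), so Greenberg's `λ = rank_{ℤ_p}` dictionary applies. [cite: GreenbergLNM1716, §1 p. 60]
[cite: GreenbergVatsal2000, §2 Cor. (2.3)] -/
theorem finite_torsionBy_and_zpCorank_eq_lambdaInvariant_ker_liftQ [Module.Finite (IwasawaAlgebra₂ p) D₂.X]
    (hγ : ZpExtension.IsTopGeneratorPair κ κ₂ γ γ₂)
    (hcont : ∀ m : M, Continuous fun σ : absoluteGaloisGroup K ↦ σ • m) (hprim : ∀ m : M, ∃ k : ℕ, p ^ k • m = 0)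
    (hκ₂ : κ₂.IsUnramifiedOutside 𝔮) (h𝔮 : ((p : ℕ) : 𝓞 K) ∈ 𝔮.asIdeal)
    (hI : ∀ y : absoluteGaloisGroup K, y ∈ ZpExtension.pairKer κ κ₂ → y ∈ inertia 𝔮 → ∀ m : M, y • m = m)
    {τ : absoluteGaloisGroup K} (hτ : τ ∈ decomp 𝔮) (hκτ : κ τ = κ γ) {u : ℤ} (hu : ∀ m : M, τ • m = u • m)
    (hpu : (p : ℤ) ∣ u - 1)
    {C : Type*} [AddCommGroup C] (πC : ↥(endInvariants (conjSel₂ κ κ₂ M 𝔮 γ₂ - 1)) →+ C) (hsurj : Function.Surjective πC)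
    (hker : ∀ s : ↥(endInvariants (conjSel₂ κ κ₂ M 𝔮 γ₂ - 1)), πC s = 0 ↔ (s : unrSelmer₂ κ κ₂ M 𝔮) ∈ g.range) :
    letI : Module (IwasawaAlgebra p) (QuotSMulTop (PowerSeries.C (PowerSeries.X : IwasawaAlgebra p) : IwasawaAlgebra₂ p) D₂.X) :=
      Module.compHom _ (PowerSeries.map (PowerSeries.C (R := ℤ_[p])))
    ∀ (φbar : QuotSMulTop (PowerSeries.C (PowerSeries.X : IwasawaAlgebra p) : IwasawaAlgebra₂ p) D₂.X →ₗ[IwasawaAlgebra p] D₁.X),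
      (∀ x : D₂.X, φbar (Submodule.Quotient.mk x) = φ x) →
      Finite (C[(p : ℤ)]) ∧ zpCorank C p = lambdaInvariant p (LinearMap.ker φbar) := by
  intro φbar hφbar
  letI instQ : Module (IwasawaAlgebra p) (QuotSMulTop (PowerSeries.C (PowerSeries.X : IwasawaAlgebra p) : IwasawaAlgebra₂ p) D₂.X) :=
    Module.compHom _ (PowerSeries.map (PowerSeries.C (R := ℤ_[p])))
  haveI : Module.Finite (IwasawaAlgebra p)
      (QuotSMulTop (PowerSeries.C (PowerSeries.X : IwasawaAlgebra p) : IwasawaAlgebra₂ p) D₂.X) :=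
    LinePinControl.moduleFinite_quotSMulTop_inner D₂
  -- the Euler factor `E = (1+T) − u = T − (u − 1)` kills `ker φ̄` (part 1), is non-zero and not in `(p)`
  have hann : ∀ q : LinearMap.ker φbar,
      (PowerSeries.X - PowerSeries.C ((u : ℤ_[p]) - 1) : IwasawaAlgebra p) • q = 0 := by
    intro q
    apply Subtype.ext
    rw [Submodule.coe_smul, Submodule.coe_zero, ← one_add_X_sub_intCast u, ← pow_one ((1 : IwasawaAlgebra p) + PowerSeries.X)]
    exact LinePinControl.euler_smul_eq_zero_of_liftQ_eq_zero hg hφ hγ hcont hprim hκ₂ h𝔮 hI hτ (n := 1) (by rw [pow_one, hκτ]) hu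
      φbar hφbar q (LinearMap.mem_ker.mp q.2)
  have hc : ((u : ℤ_[p]) - 1) ∈ IsLocalRing.maximalIdeal ℤ_[p] := by
    rw [PadicInt.maximalIdeal_eq_span_p, Ideal.mem_span_singleton]
    obtain ⟨k, hk⟩ := hpu
    exact ⟨(k : ℤ_[p]), by exact_mod_cast hk⟩
  have htors : Module.IsTorsion (IwasawaAlgebra p) (LinearMap.ker φbar) := fun {q} ↦
    ⟨⟨_, mem_nonZeroDivisors_of_ne_zero (X_sub_C_ne_zero p ((u : ℤ_[p]) - 1))⟩, hann q⟩
  have hcoe : ((Polynomial.X - Polynomial.C ((u : ℤ_[p]) - 1) : Polynomial ℤ_[p]) : IwasawaAlgebra p) =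
      PowerSeries.X - PowerSeries.C ((u : ℤ_[p]) - 1) := by
    rw [Polynomial.coe_sub, Polynomial.coe_X, Polynomial.coe_C]
  have hμ : muInvariant p (LinearMap.ker φbar) = 0 := by
    refine muInvariant_eq_zero_of_smul_eq_zero_of_notMem _ ?_ hann
    rw [← hcoe]
    exact coe_notMem_augIdealP_of_isDistinguishedAt p (isDistinguishedAt_X_sub_C p hc)
  -- `C` is `p`-primary (a quotient of a subgroup of `H¹(K̃_∞, M)`, `M` `p`-primary)
  have hC : ∀ c : C, ∃ n : ℕ, p ^ n • c = 0 := by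
    intro c
    obtain ⟨s, rfl⟩ := hsurj c
    obtain ⟨k, hk⟩ := TwoVariableSelmer.exists_pow_smul_subgroupH1_pair_eq_zero κ κ₂ M hprim
      ((s : unrSelmer₂ κ κ₂ M 𝔮) : subgroupH1 (ZpExtension.pairKer κ κ₂) M)
    refine ⟨k, ?_⟩
    rw [← map_nsmul]
    have hs0 : p ^ k • s = 0 := Subtype.ext (Subtype.ext (by
      rw [AddSubgroupClass.coe_nsmul, AddSubgroupClass.coe_nsmul, hk]; rfl))
    rw [hs0, map_zero]
  -- `ker φ̄ ≃+ Hom(C, ℚ/ℤ)` (the defect dual pair)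
  obtain ⟨δ, hδ⟩ := LinePinDefect.exists_defectDual hφ πC hsurj hker φbar hφbar
  have hinj := LinePinDefect.defectDual_injective πC φbar δ hδ
  have hsur := LinePinDefect.defectDual_surjective hg hφ hγ πC hsurj hker φbar hφbar δ hδ
  let Ψ : ↥(LinearMap.ker φbar) ≃+ CharacterModule C := AddEquiv.ofBijective δ ⟨hinj, hsur⟩
  exact Rank1Residual.X2.NonPrimitiveSelmerCorank.finite_torsionBy_and_zpCorank_eq_lambdaInvariant p (LinearMap.ker φbar)
    htors hμ hC Ψ

/-- **`ch_Λ(ker φ̄) = ((1+T) − u)^{corank_{ℤ_p}(coker g)}`** — the characteristic ideal of the `v̄`-defect module of the `v`-line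
control identity (C5), for an undecomposed `v̄`, as a power of the Euler factor at `v̄` whose exponent is the `ℤ_p`-corank of the
cokernel of control (presented by any `πC`). Parts 1–2 + the corank dictionary. [cite: GreenbergVatsal2000, §2 Prop. (2.4)]
[cite: GreenbergLNM1716, §1 p. 60] -/
theorem charIdeal_ker_liftQ_eq_span_pow_zpCorank [Module.Finite (IwasawaAlgebra₂ p) D₂.X]
    (hγ : ZpExtension.IsTopGeneratorPair κ κ₂ γ γ₂)
    (hcont : ∀ m : M, Continuous fun σ : absoluteGaloisGroup K ↦ σ • m) (hprim : ∀ m : M, ∃ k : ℕ, p ^ k • m = 0)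
    (hκ₂ : κ₂.IsUnramifiedOutside 𝔮) (h𝔮 : ((p : ℕ) : 𝓞 K) ∈ 𝔮.asIdeal)
    (hI : ∀ y : absoluteGaloisGroup K, y ∈ ZpExtension.pairKer κ κ₂ → y ∈ inertia 𝔮 → ∀ m : M, y • m = m)
    {τ : absoluteGaloisGroup K} (hτ : τ ∈ decomp 𝔮) (hκτ : κ τ = κ γ) {u : ℤ} (hu : ∀ m : M, τ • m = u • m)
    (hpu : (p : ℤ) ∣ u - 1)
    {C : Type*} [AddCommGroup C] (πC : ↥(endInvariants (conjSel₂ κ κ₂ M 𝔮 γ₂ - 1)) →+ C) (hsurj : Function.Surjective πC)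
    (hker : ∀ s : ↥(endInvariants (conjSel₂ κ κ₂ M 𝔮 γ₂ - 1)), πC s = 0 ↔ (s : unrSelmer₂ κ κ₂ M 𝔮) ∈ g.range) :
    letI : Module (IwasawaAlgebra p) (QuotSMulTop (PowerSeries.C (PowerSeries.X : IwasawaAlgebra p) : IwasawaAlgebra₂ p) D₂.X) :=
      Module.compHom _ (PowerSeries.map (PowerSeries.C (R := ℤ_[p])))
    ∀ (φbar : QuotSMulTop (PowerSeries.C (PowerSeries.X : IwasawaAlgebra p) : IwasawaAlgebra₂ p) D₂.X →ₗ[IwasawaAlgebra p] D₁.X),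
      (∀ x : D₂.X, φbar (Submodule.Quotient.mk x) = φ x) →
      charIdeal (IwasawaAlgebra p) (LinearMap.ker φbar) =
        Ideal.span {((1 : IwasawaAlgebra p) + PowerSeries.X) - (u : IwasawaAlgebra p)} ^ zpCorank C p := by
  intro φbar hφbar
  obtain ⟨-, hcork⟩ := finite_torsionBy_and_zpCorank_eq_lambdaInvariant_ker_liftQ hg hφ hγ hcont hprim hκ₂ h𝔮 hI hτ hκτ hu hpu
    πC hsurj hker φbar hφbar
  rw [hcork]
  exact charIdeal_ker_liftQ_eq_span_pow_lambdaInvariant hg hφ hγ hcont hprim hκ₂ h𝔮 hI hτ hκτ hu hpu φbar hφbar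

/-- **(LS)_v FORM: `corank_{ℤ_p}(coker g) = 1 ⟹ ch_Λ(ker φ̄) = ((1+T) − u)`** — the `v̄`-defect term of the `v`-line control identity IS the
Euler factor at `v̄` as soon as the cokernel of control has `ℤ_p`-corank one (localisation onto the `v̄`-receptacle onto up to finite).
[cite: GreenbergVatsal2000, §2 Cor. (2.3), Prop. (2.4)] -/
theorem charIdeal_ker_liftQ_eq_span_of_zpCorank_eq_one [Module.Finite (IwasawaAlgebra₂ p) D₂.X]
    (hγ : ZpExtension.IsTopGeneratorPair κ κ₂ γ γ₂)
    (hcont : ∀ m : M, Continuous fun σ : absoluteGaloisGroup K ↦ σ • m) (hprim : ∀ m : M, ∃ k : ℕ, p ^ k • m = 0)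
    (hκ₂ : κ₂.IsUnramifiedOutside 𝔮) (h𝔮 : ((p : ℕ) : 𝓞 K) ∈ 𝔮.asIdeal)
    (hI : ∀ y : absoluteGaloisGroup K, y ∈ ZpExtension.pairKer κ κ₂ → y ∈ inertia 𝔮 → ∀ m : M, y • m = m)
    {τ : absoluteGaloisGroup K} (hτ : τ ∈ decomp 𝔮) (hκτ : κ τ = κ γ) {u : ℤ} (hu : ∀ m : M, τ • m = u • m)
    (hpu : (p : ℤ) ∣ u - 1)
    {C : Type*} [AddCommGroup C] (πC : ↥(endInvariants (conjSel₂ κ κ₂ M 𝔮 γ₂ - 1)) →+ C) (hsurj : Function.Surjective πC)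
    (hker : ∀ s : ↥(endInvariants (conjSel₂ κ κ₂ M 𝔮 γ₂ - 1)), πC s = 0 ↔ (s : unrSelmer₂ κ κ₂ M 𝔮) ∈ g.range)
    (hLS : zpCorank C p = 1) :
    letI : Module (IwasawaAlgebra p) (QuotSMulTop (PowerSeries.C (PowerSeries.X : IwasawaAlgebra p) : IwasawaAlgebra₂ p) D₂.X) :=
      Module.compHom _ (PowerSeries.map (PowerSeries.C (R := ℤ_[p])))
    ∀ (φbar : QuotSMulTop (PowerSeries.C (PowerSeries.X : IwasawaAlgebra p) : IwasawaAlgebra₂ p) D₂.X →ₗ[IwasawaAlgebra p] D₁.X),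
      (∀ x : D₂.X, φbar (Submodule.Quotient.mk x) = φ x) →
      charIdeal (IwasawaAlgebra p) (LinearMap.ker φbar) =
        Ideal.span {((1 : IwasawaAlgebra p) + PowerSeries.X) - (u : IwasawaAlgebra p)} := by
  intro φbar hφbar
  have h := charIdeal_ker_liftQ_eq_span_pow_zpCorank hg hφ hγ hcont hprim hκ₂ h𝔮 hI hτ hκτ hu hpu πC hsurj hker φbar hφbar
  rw [hLS, pow_one] at h
  exact h

/-! ## General `n`: `ch_Λ(ker φ̄) = (E)^ℓ` whenever the Euler factor `E = (1+T)^n − u` is PRIME in `Λ`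
(e.g. `p = 2`, `u = −1`, `n = 2^s`: `(1+T)^{2^s} + 1` is Eisenstein) -/

/-- **General `n`, prime Euler factor: `ch_Λ(ker φ̄) = ((1+T)^n − u)^ℓ` with `λ(ker φ̄) = ℓ · λ(Λ⧸((1+T)^n − u))`** — for any `τ ∈ D_𝔮`
with `κ τ = κ (γ^n)`, `n ≠ 0`, acting on `M` as `u`, provided `E = (1+T)^n − u` is a prime element of `Λ` (for `p = 2`, `u = −1`, `n = 2^s`
it is the Eisenstein polynomial `(1+T)^{2^s} + 1`; for `u = 1` only `n = 1` qualifies). Part 1's annihilator + part 2's structure lemma.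
[cite: GreenbergVatsal2000, §2 Prop. (2.4)] [cite: Washington1997, §13.2] -/
theorem exists_charIdeal_ker_liftQ_eq_span_pow_of_prime [Module.Finite (IwasawaAlgebra₂ p) D₂.X]
    (hγ : ZpExtension.IsTopGeneratorPair κ κ₂ γ γ₂)
    (hcont : ∀ m : M, Continuous fun σ : absoluteGaloisGroup K ↦ σ • m) (hprim : ∀ m : M, ∃ k : ℕ, p ^ k • m = 0)
    (hκ₂ : κ₂.IsUnramifiedOutside 𝔮) (h𝔮 : ((p : ℕ) : 𝓞 K) ∈ 𝔮.asIdeal)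
    (hI : ∀ y : absoluteGaloisGroup K, y ∈ ZpExtension.pairKer κ κ₂ → y ∈ inertia 𝔮 → ∀ m : M, y • m = m)
    {τ : absoluteGaloisGroup K} (hτ : τ ∈ decomp 𝔮) {n : ℕ} (hn : n ≠ 0) (hκτ : κ τ = κ (γ ^ n)) {u : ℤ} (hu : ∀ m : M, τ • m = u • m)
    (hE : Prime ((((1 : IwasawaAlgebra p) + PowerSeries.X) ^ n - (u : IwasawaAlgebra p)))) :
    letI : Module (IwasawaAlgebra p) (QuotSMulTop (PowerSeries.C (PowerSeries.X : IwasawaAlgebra p) : IwasawaAlgebra₂ p) D₂.X) :=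
      Module.compHom _ (PowerSeries.map (PowerSeries.C (R := ℤ_[p])))
    ∀ (φbar : QuotSMulTop (PowerSeries.C (PowerSeries.X : IwasawaAlgebra p) : IwasawaAlgebra₂ p) D₂.X →ₗ[IwasawaAlgebra p] D₁.X),
      (∀ x : D₂.X, φbar (Submodule.Quotient.mk x) = φ x) →
      ∃ ℓ : ℕ, charIdeal (IwasawaAlgebra p) (LinearMap.ker φbar) =
          Ideal.span {((1 : IwasawaAlgebra p) + PowerSeries.X) ^ n - (u : IwasawaAlgebra p)} ^ ℓ ∧
        lambdaInvariant p (LinearMap.ker φbar) =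
          ℓ * lambdaInvariant p (IwasawaAlgebra p ⧸ Ideal.span {((1 : IwasawaAlgebra p) + PowerSeries.X) ^ n - (u : IwasawaAlgebra p)}) := by
  intro φbar hφbar
  letI instQ : Module (IwasawaAlgebra p) (QuotSMulTop (PowerSeries.C (PowerSeries.X : IwasawaAlgebra p) : IwasawaAlgebra₂ p) D₂.X) :=
    Module.compHom _ (PowerSeries.map (PowerSeries.C (R := ℤ_[p])))
  haveI : Module.Finite (IwasawaAlgebra p)
      (QuotSMulTop (PowerSeries.C (PowerSeries.X : IwasawaAlgebra p) : IwasawaAlgebra₂ p) D₂.X) :=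
    LinePinControl.moduleFinite_quotSMulTop_inner D₂
  have hann : ∀ q : LinearMap.ker φbar, (((1 : IwasawaAlgebra p) + PowerSeries.X) ^ n - (u : IwasawaAlgebra p)) • q = 0 := by
    intro q
    apply Subtype.ext
    rw [Submodule.coe_smul, Submodule.coe_zero]
    exact LinePinControl.euler_smul_eq_zero_of_liftQ_eq_zero hg hφ hγ hcont hprim hκ₂ h𝔮 hI hτ hκτ hu φbar hφbar q
      (LinearMap.mem_ker.mp q.2)
  have htors : Module.IsTorsion (IwasawaAlgebra p) (LinearMap.ker φbar) := fun {q} ↦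
    ⟨⟨_, mem_nonZeroDivisors_of_ne_zero hE.ne_zero⟩, hann q⟩
  have hEp : ∀ a : ℕ, ¬ (((1 : IwasawaAlgebra p) + PowerSeries.X) ^ n - (u : IwasawaAlgebra p)) ∣
      (PowerSeries.C (p : ℤ_[p]) : IwasawaAlgebra p) ^ a := by
    intro a h
    have h1 := hE.dvd_of_dvd_pow h
    have h2 := (hE.associated_of_dvd (prime_C p) h1).symm.dvd
    exact not_C_p_dvd_one_add_X_pow_sub_intCast hn u h2
  exact exists_charIdeal_eq_span_pow_of_prime_smul_eq_zero (LinearMap.ker φbar) htors hE hEp hann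

end Summit.BirchSwinnertonDyer.BirchSwinnertonDyer.Theorems.PrintCf2.LinePin

end
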